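import Literature.RepresentationTheory.Kovacevic2021.SU21SubquotientModule
import Literature.RepresentationTheory.Kovacevic2021.SU21PrincipalSeriesSubquotients
import Literature.RepresentationTheory.Kovacevic2021.SU21ModelRecognition
import Literature.RepresentationTheory.Kovacevic2021.SU21PrincipalSeriesCohomologicalPoints
import HarnessLib

/-!
# The composition factors of the principal series `V(0,0)` of `SU(2,1)` are `J_{0,0}`, `J_{1,0}`, `J_{0,1}`, `D_1`

Continuation of `…Kovacevic2021.SU21PrincipalSeriesCohomologicalPoints` (the root lines of `a`, `b` cut the cone of
`K`-types of `V(0,0)` into the `K`-type SUPPORTS of `U(0)`, `Z(3)`, `Z(−3)`, `W(3,0)`; the Lie span of a single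
`K`-type is the vertex, a strip, or everything), `…SU21SubquotientData` / `…SU21SubquotientModule` (the subquotient
datum of two Lie submodules and the isomorphism `N₂ ⧸ (N₁ ⊓ N₂) ≃ (subquotient datum).V`),
`…SU21PrincipalSeriesSubquotients` (a subquotient of `V(c,2t)` whose `K`-types form a product cell with live internal
arrows is strongly connected, with the Casimir scalar of `V(c,2t)`) and `…SU21ModelRecognition` (a strongly connected
datum with the `K`-types of one of the six cohomological modules is isomorphic to it).

**What is proved** — the identification AS `𝔤𝔩(3,ℂ)`-MODULES, up to isomorphism, of the composition factors of
Kovačević's `V(0,0) = V(c(0), 0)` [Kovacevic2021, §3 Thm 3, §4] — the principal series of `SU(2,1)` at the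
infinitesimal character `ρ` [BorelWallach2000, VI 4.10 (10): constituents `J_{0,0}, J_{1,0}, J_{0,1}, D_1`]:
with `N_v = ⟨V_{1,0}⟩`, `N_row = ⟨V_{2,3}⟩` (the `K`-types `V_{1+p,3p}`), `N_col = ⟨V_{2,−3}⟩` (the `K`-types
`V_{1+q,−3q}`) the Lie submodules of `SU21PrincipalSeriesCohomologicalPoints §1`,
* `N_v ≅ U(0) = trivialMod` (`rho_vertex_factor`),
* `N_row ⧸ N_v ≅ Z(3) = ladderPlus` (`rho_row_factor`), `N_col ⧸ N_v ≅ Z(−3) = ladderMinus` (`rho_col_factor`) and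
  also `(N_row + N_col) ⧸ N_row ≅ Z(−3)` (`rho_join_factor`, the third step of the composition SERIES
  `0 ⊂ N_v ⊂ N_row ⊂ N_row + N_col ⊂ V(0,0)`),
* `V(0,0) ⧸ (N_row + N_col) ≅ W(3,0) = midDS` (`rho_top_factor`),
each factor being irreducible; the quotients are by `ker sqHom = N₁.comap N₂.incl` (`SU21SubquotientModule.ker_sqHom`).
The companion `SU21HolomorphicCompositionFactors` treats `V(−3/2, ±6)` the same way.

DEFINITIONS (with bodies): `span00Vertex`, `span00Row`, `span00Col` (the three Lie spans above).  No named facts.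

## References

* D. Kovačević, *Unitary `(𝔤,K)` modules of `SU(2,1)`*, Acta Math. Spalatensia 1 (2021) 105–125
  (arXiv:1810.01752): §3 Thm 3, Remark 6; §4 (`c(0) = 0`, `U(0)`, `Z(±3)`, `W(3,0)`). [Kovacevic2021]
* A. Borel, N. Wallach (2000), VI 4.8, 4.10 (10), Thm 4.11 pp. 131–132. [BorelWallach2000]
-/

noncomputable section

namespace Literature.RepresentationTheory.Kovacevic2021

-- Mathlib idiom (Mathlib/Algebra/Lie/OfAssociative.lean): commutator brackets on associative algebras; needed for
-- the `𝔤𝔩(3,ℂ)`-module structure on `𝒟.V`, as in every file of this directory.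
attribute [local instance 100] LieRing.ofAssociativeRing

namespace SU21Datum

open PrincipalSeries

/-! ## §1 The three Lie submodules of `V(0,0)` -/

/-- `N_v = ⟨u^1_{1,0}⟩`: the Lie submodule of `V(0,0)` generated by the vertex `V_{1,0}` (its `K`-types: the vertex
alone). [cite: Kovacevic2021, §4 (`U(0) = V_{10}`)] [cite: BorelWallach2000, VI 4.10 (10)] -/
def span00Vertex : LieSubmodule ℂ (Matrix (Fin 3) (Fin 3) ℂ) (principalSeries 0 0).V :=
  LieSubmodule.lieSpan ℂ (Matrix (Fin 3) (Fin 3) ℂ) {(principalSeries 0 0).vec (1 + 0 + 0) (2 * 0 + 3 * 0 - 3 * 0) 1}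

/-- `N_row = ⟨u^1_{2,3}⟩`: the Lie submodule of `V(0,0)` generated by `V_{2,3}` (its `K`-types: the row `q = 0`,
`V_{1+p,3p}`). [cite: Kovacevic2021, §3 proof of Thm 3 ("a strip"), §4 (`Z(3)`)] [cite: BorelWallach2000, VI 4.10 (10)] -/
def span00Row : LieSubmodule ℂ (Matrix (Fin 3) (Fin 3) ℂ) (principalSeries 0 0).V :=
  LieSubmodule.lieSpan ℂ (Matrix (Fin 3) (Fin 3) ℂ) {(principalSeries 0 0).vec (1 + 1 + 0) (2 * 0 + 3 * 1 - 3 * 0) 1}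

/-- `N_col = ⟨u^1_{2,−3}⟩`: the Lie submodule of `V(0,0)` generated by `V_{2,−3}` (its `K`-types: the column `p = 0`,
`V_{1+q,−3q}`). [cite: Kovacevic2021, §3 proof of Thm 3, §4 (`Z(−3)`)] [cite: BorelWallach2000, VI 4.10 (10)] -/
def span00Col : LieSubmodule ℂ (Matrix (Fin 3) (Fin 3) ℂ) (principalSeries 0 0).V :=
  LieSubmodule.lieSpan ℂ (Matrix (Fin 3) (Fin 3) ℂ) {(principalSeries 0 0).vec (1 + 0 + 1) (2 * 0 + 3 * 0 - 3 * 1) 1}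

/-- a cone point of `V(0,0)` is a `K`-type [cite: Kovacevic2021, §3 Thm 3] -/
private theorem mem00 {p q : ℤ} (hp : 0 ≤ p) (hq : 0 ≤ q) :
    ((1 + p + q, 2 * 0 + 3 * p - 3 * q) : ℤ × ℤ) ∈ (principalSeries 0 0).S :=
  mem_cone hp hq rfl rfl

/-! ## §2 The composition factors of `V(0,0)` -/

/-- the `K`-types of the sub-datum `N_v`: the vertex `(p,q) = (0,0)` [cite: Kovacevic2021, §4 (`U(0)`)] -/
theorem rho_vertex_mem_iff {p q : ℤ} (hp : 0 ≤ p) (hq : 0 ≤ q) :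
    ((1 + p + q, 2 * 0 + 3 * p - 3 * q) : ℤ × ℤ) ∈ (principalSeries 0 0).sqSet ⊥ span00Vertex ↔
      p ∈ ({0} : Set ℤ) ∧ q ∈ ({0} : Set ℤ) := by
  rw [mem_sqSet_bot_iff, span00Vertex, principalSeries_zero_zero_vec_mem_lieSpan_vertex_iff hp hq,
    Set.mem_singleton_iff, Set.mem_singleton_iff, and_iff_right (mem00 hp hq)]

/-- **`J_{0,0} = U(0)`: the vertex `V_{1,0}` of `V(0,0)` spans the trivial module** — the sub-datum of `N_v` has the
`K`-types of `trivialMod`, is irreducible, and `N_v ≃ trivialMod.V` as `𝔤𝔩(3,ℂ)`-modules.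
[cite: Kovacevic2021, §4 ("`U(0) = V_{10}` is one-dimensional")] [cite: BorelWallach2000, VI 4.10 (10) (`J_{0,0}`)] -/
theorem rho_vertex_factor :
    ((principalSeries 0 0).subquotient ⊥ span00Vertex).S = trivialMod.S ∧
      LieModule.IsIrreducible ℂ (Matrix (Fin 3) (Fin 3) ℂ) ((principalSeries 0 0).subquotient ⊥ span00Vertex).V ∧
      Nonempty (span00Vertex ≃ₗ⁅ℂ, Matrix (Fin 3) (Fin 3) ℂ⁆ trivialMod.V) := by
  have hmem := fun p q (hp : (0 : ℤ) ≤ p) (hq : (0 : ℤ) ≤ q) => rho_vertex_mem_iff hp hq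
  have hS : ((principalSeries 0 0).subquotient ⊥ span00Vertex).S = trivialMod.S :=
    subquotient_principalSeries_S_eq hmem fun n m => by
      rw [mem_trivialMod_iff]
      simp only [Set.mem_singleton_iff]
      constructor
      · rintro ⟨rfl, rfl⟩; exact ⟨0, 0, le_rfl, le_rfl, by norm_num, by norm_num, rfl, rfl⟩
      · rintro ⟨p, q, -, -, rfl, rfl, rfl, rfl⟩; norm_num
  have hconn := subquotient_principalSeries_reach Set.ordConnected_singleton Set.ordConnected_singleton
    (by simp) (by simp) hmem (fun p hp hp1 => by simp only [Set.mem_singleton_iff] at hp hp1; omega)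
    (fun q hq hq1 => by simp only [Set.mem_singleton_iff] at hq hq1; omega)
  obtain ⟨e⟩ := nonempty_equiv_trivialMod_of_S_eq hS hconn
    fun m h => subquotient_principalSeries_casimirScalar (by norm_num) h
  refine ⟨hS, isIrreducible_of_forall_reach (by rw [hS]; exact ⟨(1, 0), rfl⟩) hconn, ⟨(sqEquivOfBot _ _).trans e⟩⟩

/-- the `K`-types of `N_row ⧸ N_v`: the row `q = 0` minus the vertex [cite: Kovacevic2021, §3 proof of Thm 3, §4 (`Z(3)`)] -/
theorem rho_row_mem_iff {p q : ℤ} (hp : 0 ≤ p) (hq : 0 ≤ q) :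
    ((1 + p + q, 2 * 0 + 3 * p - 3 * q) : ℤ × ℤ) ∈ (principalSeries 0 0).sqSet span00Vertex span00Row ↔
      p ∈ Set.Ici (1 : ℤ) ∧ q ∈ ({0} : Set ℤ) := by
  rw [mem_sqSet_iff, span00Row, span00Vertex, principalSeries_zero_zero_vec_mem_lieSpan_iff_of_q_zero le_rfl hp hq,
    principalSeries_zero_zero_vec_mem_lieSpan_vertex_iff hp hq, Set.mem_Ici, Set.mem_singleton_iff,
    and_iff_right (mem00 hp hq)]
  omega

/-- **`J_{1,0} = Z(3)` is the composition factor `N_row ⧸ N_v` of `V(0,0)`**: the subquotient datum has the `K`-types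
of `ladderPlus`, is irreducible, and `N_row ⧸ N_v ≃ ladderPlus.V` as `𝔤𝔩(3,ℂ)`-modules (quotient by
`ker sqHom = N_v.comap N_row.incl`). [cite: Kovacevic2021, §4 (`Z(3)`)] [cite: BorelWallach2000, VI 4.10 (10) (`J_{1,0}`)] -/
theorem rho_row_factor :
    ((principalSeries 0 0).subquotient span00Vertex span00Row).S = ladderPlus.S ∧
      LieModule.IsIrreducible ℂ (Matrix (Fin 3) (Fin 3) ℂ)
        ((principalSeries 0 0).subquotient span00Vertex span00Row).V ∧
      Nonempty ((span00Row ⧸ ((principalSeries 0 0).sqHom span00Vertex span00Row).ker) ≃ₗ⁅ℂ, Matrix (Fin 3) (Fin 3) ℂ⁆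
        ladderPlus.V) := by
  have hmem := fun p q (hp : (0 : ℤ) ≤ p) (hq : (0 : ℤ) ≤ q) => rho_row_mem_iff hp hq
  have hS : ((principalSeries 0 0).subquotient span00Vertex span00Row).S = ladderPlus.S :=
    subquotient_principalSeries_S_eq hmem fun n m => by
      rw [mem_ladderPlus]
      simp only [Set.mem_Ici, Set.mem_singleton_iff]
      constructor
      · rintro ⟨h1, h2⟩; exact ⟨n - 1, 0, by omega, le_rfl, by omega, by omega, by omega, rfl⟩
      · rintro ⟨p, q, hp, -, rfl, rfl, h1, rfl⟩; omega
  have hconn := subquotient_principalSeries_reach Set.ordConnected_Ici Set.ordConnected_singleton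
    (fun p hp => by simp only [Set.mem_Ici] at hp; omega) (by simp) hmem
    (fun p hp _ => by rw [Set.mem_Ici] at hp; rw [Ne, acoef_zero_zero_eq_zero_iff (by omega)]; omega)
    (fun q hq hq1 => by simp only [Set.mem_singleton_iff] at hq hq1; omega)
  obtain ⟨e⟩ := nonempty_equiv_ladderPlus_of_S_eq hS hconn
  exact ⟨hS, isIrreducible_of_forall_reach (by rw [hS]; exact ⟨(2, 3), (mem_ladderPlus 2 3).2 ⟨le_rfl, by norm_num⟩⟩)
    hconn, ⟨(sqEquiv _ _ _).trans e⟩⟩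

/-- the `K`-types of `N_col ⧸ N_v`: the column `p = 0` minus the vertex [cite: Kovacevic2021, §3 proof of Thm 3, §4 (`Z(−3)`)] -/
theorem rho_col_mem_iff {p q : ℤ} (hp : 0 ≤ p) (hq : 0 ≤ q) :
    ((1 + p + q, 2 * 0 + 3 * p - 3 * q) : ℤ × ℤ) ∈ (principalSeries 0 0).sqSet span00Vertex span00Col ↔
      p ∈ ({0} : Set ℤ) ∧ q ∈ Set.Ici (1 : ℤ) := by
  rw [mem_sqSet_iff, span00Col, span00Vertex, principalSeries_zero_zero_vec_mem_lieSpan_iff_of_p_zero le_rfl hp hq,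
    principalSeries_zero_zero_vec_mem_lieSpan_vertex_iff hp hq, Set.mem_Ici, Set.mem_singleton_iff,
    and_iff_right (mem00 hp hq)]
  omega

/-- **`J_{0,1} = Z(−3)` is the composition factor `N_col ⧸ N_v` of `V(0,0)`**: the subquotient datum has the `K`-types
of `ladderMinus`, is irreducible, and `N_col ⧸ N_v ≃ ladderMinus.V` as `𝔤𝔩(3,ℂ)`-modules.
[cite: Kovacevic2021, §4 (`Z(−3)`)] [cite: BorelWallach2000, VI 4.10 (10) (`J_{0,1}`)] -/
theorem rho_col_factor :
    ((principalSeries 0 0).subquotient span00Vertex span00Col).S = ladderMinus.S ∧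
      LieModule.IsIrreducible ℂ (Matrix (Fin 3) (Fin 3) ℂ)
        ((principalSeries 0 0).subquotient span00Vertex span00Col).V ∧
      Nonempty ((span00Col ⧸ ((principalSeries 0 0).sqHom span00Vertex span00Col).ker) ≃ₗ⁅ℂ, Matrix (Fin 3) (Fin 3) ℂ⁆
        ladderMinus.V) := by
  have hmem := fun p q (hp : (0 : ℤ) ≤ p) (hq : (0 : ℤ) ≤ q) => rho_col_mem_iff hp hq
  have hS : ((principalSeries 0 0).subquotient span00Vertex span00Col).S = ladderMinus.S :=
    subquotient_principalSeries_S_eq hmem fun n m => by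
      rw [mem_ladderMinus]
      simp only [Set.mem_Ici, Set.mem_singleton_iff]
      constructor
      · rintro ⟨h1, h2⟩; exact ⟨0, n - 1, le_rfl, by omega, by omega, by omega, rfl, by omega⟩
      · rintro ⟨p, q, -, hq, rfl, rfl, rfl, h1⟩; omega
  have hconn := subquotient_principalSeries_reach Set.ordConnected_singleton Set.ordConnected_Ici
    (by simp) (fun q hq => by simp only [Set.mem_Ici] at hq; omega) hmem
    (fun p hp hp1 => by simp only [Set.mem_singleton_iff] at hp hp1; omega)
    (fun q hq _ => by rw [Set.mem_Ici] at hq; rw [Ne, bcoef_zero_zero_eq_zero_iff (by omega)]; omega)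
  obtain ⟨e⟩ := nonempty_equiv_ladderMinus_of_S_eq hS hconn
  exact ⟨hS, isIrreducible_of_forall_reach
    (by rw [hS]; exact ⟨(2, -3), (mem_ladderMinus 2 (-3)).2 ⟨le_rfl, by norm_num⟩⟩) hconn, ⟨(sqEquiv _ _ _).trans e⟩⟩

/-- the `K`-types of `(N_row + N_col) ⧸ N_row`: again the column `p = 0` minus the vertex (the subquotient datum depends
only on the `K`-type sets met). [cite: Kovacevic2021, §3 Remark 6, §4 (`Z(−3)`)] -/
theorem rho_join_mem_iff {p q : ℤ} (hp : 0 ≤ p) (hq : 0 ≤ q) :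
    ((1 + p + q, 2 * 0 + 3 * p - 3 * q) : ℤ × ℤ) ∈ (principalSeries 0 0).sqSet span00Row (span00Row ⊔ span00Col) ↔
      p ∈ ({0} : Set ℤ) ∧ q ∈ Set.Ici (1 : ℤ) := by
  rw [mem_sqSet_iff, vec_one_mem_sup_iff _ _ (mem00 hp hq), span00Row, span00Col,
    principalSeries_zero_zero_vec_mem_lieSpan_iff_of_q_zero le_rfl hp hq,
    principalSeries_zero_zero_vec_mem_lieSpan_iff_of_p_zero le_rfl hp hq, Set.mem_Ici, Set.mem_singleton_iff,
    and_iff_right (mem00 hp hq)]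
  omega

/-- **The composition series `0 ⊂ N_v ⊂ N_row ⊂ N_row + N_col ⊂ V(0,0)`, third step**: `(N_row + N_col) ⧸ N_row ≅ Z(−3) =
ladderMinus` (same subquotient datum as `N_col ⧸ N_v`).  With `rho_vertex_factor`, `rho_row_factor` and `rho_top_factor`
this is the composition series of the principal series at `ρ` with factors `J_{0,0}, J_{1,0}, J_{0,1}, D_1`.
[cite: BorelWallach2000, VI 4.10 (10)] [cite: Kovacevic2021, §4] -/
theorem rho_join_factor :
    ((principalSeries 0 0).subquotient span00Row (span00Row ⊔ span00Col)).S = ladderMinus.S ∧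
      LieModule.IsIrreducible ℂ (Matrix (Fin 3) (Fin 3) ℂ)
        ((principalSeries 0 0).subquotient span00Row (span00Row ⊔ span00Col)).V ∧
      Nonempty (((↥(span00Row ⊔ span00Col)) ⧸ ((principalSeries 0 0).sqHom span00Row (span00Row ⊔ span00Col)).ker) ≃ₗ⁅ℂ,
        Matrix (Fin 3) (Fin 3) ℂ⁆ ladderMinus.V) := by
  have hmem := fun p q (hp : (0 : ℤ) ≤ p) (hq : (0 : ℤ) ≤ q) => rho_join_mem_iff hp hq
  have hS : ((principalSeries 0 0).subquotient span00Row (span00Row ⊔ span00Col)).S = ladderMinus.S :=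
    subquotient_principalSeries_S_eq hmem fun n m => by
      rw [mem_ladderMinus]
      simp only [Set.mem_Ici, Set.mem_singleton_iff]
      constructor
      · rintro ⟨h1, h2⟩; exact ⟨0, n - 1, le_rfl, by omega, by omega, by omega, rfl, by omega⟩
      · rintro ⟨p, q, -, hq, rfl, rfl, rfl, h1⟩; omega
  have hconn := subquotient_principalSeries_reach Set.ordConnected_singleton Set.ordConnected_Ici
    (by simp) (fun q hq => by simp only [Set.mem_Ici] at hq; omega) hmem
    (fun p hp hp1 => by simp only [Set.mem_singleton_iff] at hp hp1; omega)
    (fun q hq _ => by rw [Set.mem_Ici] at hq; rw [Ne, bcoef_zero_zero_eq_zero_iff (by omega)]; omega)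
  obtain ⟨e⟩ := nonempty_equiv_ladderMinus_of_S_eq hS hconn
  exact ⟨hS, isIrreducible_of_forall_reach
    (by rw [hS]; exact ⟨(2, -3), (mem_ladderMinus 2 (-3)).2 ⟨le_rfl, by norm_num⟩⟩) hconn, ⟨(sqEquiv _ _ _).trans e⟩⟩

/-- the `K`-types of `V(0,0) ⧸ (N_row + N_col)`: the open quadrant `p, q ≥ 1` [cite: Kovacevic2021, §3 proof of Thm 3, §4 (`W(3,0)`)] -/
theorem rho_top_mem_iff {p q : ℤ} (hp : 0 ≤ p) (hq : 0 ≤ q) :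
    ((1 + p + q, 2 * 0 + 3 * p - 3 * q) : ℤ × ℤ) ∈ (principalSeries 0 0).sqSet (span00Row ⊔ span00Col) ⊤ ↔
      p ∈ Set.Ici (1 : ℤ) ∧ q ∈ Set.Ici (1 : ℤ) := by
  rw [mem_sqSet_top_iff, vec_one_mem_sup_iff _ _ (mem00 hp hq), span00Row, span00Col,
    principalSeries_zero_zero_vec_mem_lieSpan_iff_of_q_zero le_rfl hp hq,
    principalSeries_zero_zero_vec_mem_lieSpan_iff_of_p_zero le_rfl hp hq, Set.mem_Ici, Set.mem_Ici,
    and_iff_right (mem00 hp hq)]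
  omega

/-- **`D_1 = W(3,0)` is the top composition factor `V(0,0) ⧸ (N_row + N_col)`**: the quotient datum has the `K`-types of
`midDS`, is irreducible, and `V(0,0) ⧸ (N_row ⊔ N_col) ≃ midDS.V` as `𝔤𝔩(3,ℂ)`-modules (`N_row ⊔ N_col` is the largest
proper submodule: every interior `K`-type generates `V(0,0)`, `principalSeries_zero_zero_lieSpan_eq_top`).
[cite: Kovacevic2021, §4 (`W(3,0)`)] [cite: BorelWallach2000, VI 4.10 (10) (`D_1`)] -/
theorem rho_top_factor :
    ((principalSeries 0 0).subquotient (span00Row ⊔ span00Col) ⊤).S = midDS.S ∧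
      LieModule.IsIrreducible ℂ (Matrix (Fin 3) (Fin 3) ℂ)
        ((principalSeries 0 0).subquotient (span00Row ⊔ span00Col) ⊤).V ∧
      Nonempty (((⊤ : LieSubmodule ℂ (Matrix (Fin 3) (Fin 3) ℂ) (principalSeries 0 0).V) ⧸
          ((principalSeries 0 0).sqHom (span00Row ⊔ span00Col) ⊤).ker) ≃ₗ⁅ℂ, Matrix (Fin 3) (Fin 3) ℂ⁆ midDS.V) := by
  have hmem := fun p q (hp : (0 : ℤ) ≤ p) (hq : (0 : ℤ) ≤ q) => rho_top_mem_iff hp hq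
  have hS : ((principalSeries 0 0).subquotient (span00Row ⊔ span00Col) ⊤).S = midDS.S :=
    subquotient_principalSeries_S_eq hmem fun n m => by
      rw [mem_midDS_iff_int]
      simp only [Set.mem_Ici]
      constructor
      · rintro ⟨p, q, hp, hq, rfl, rfl⟩; exact ⟨p, q, by omega, by omega, rfl, by omega, hp, hq⟩
      · rintro ⟨p, q, -, -, rfl, rfl, hp, hq⟩; exact ⟨p, q, hp, hq, rfl, by omega⟩
  have hconn := subquotient_principalSeries_reach Set.ordConnected_Ici Set.ordConnected_Ici
    (fun p hp => by simp only [Set.mem_Ici] at hp; omega) (fun q hq => by simp only [Set.mem_Ici] at hq; omega) hmem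
    (fun p hp _ => by rw [Set.mem_Ici] at hp; rw [Ne, acoef_zero_zero_eq_zero_iff (by omega)]; omega)
    (fun q hq _ => by rw [Set.mem_Ici] at hq; rw [Ne, bcoef_zero_zero_eq_zero_iff (by omega)]; omega)
  obtain ⟨e⟩ := nonempty_equiv_midDS_of_S_eq hS hconn
  exact ⟨hS, isIrreducible_of_forall_reach
    (by rw [hS]; exact ⟨(3, 0), (mem_midDS_iff_int 3 0).2 ⟨1, 1, le_rfl, le_rfl, by norm_num, by norm_num⟩⟩) hconn,
    ⟨(sqEquiv _ _ _).trans e⟩⟩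

end SU21Datum

end Literature.RepresentationTheory.Kovacevic2021
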